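import Mathlib
import Summits.Ventures.HodgeRepro.Tier4.Line1.RTFSetting
import Summits.Ventures.HodgeRepro.Tier4.Line1.LeftTypeOfMatrixCoeff
import Summits.Ventures.HodgeRepro.Tier4.Line1.IsotypicIdempotent
import Summits.Ventures.HodgeRepro.Tier4.Line1.IsotypicHeckeAlgebra

/-!
# Tier4/Line1/HeckeAlgLeftType — (C-TYPE): EVERY ELEMENT OF THE TYPE-σ HECKE ALGEBRA `H_σ` HAS FINITE-RANK LEFT-`K`-TYPE
(rank `d²`; plan-1 g3's cut S14477 on its Sketch-CType.lean statements, TAKEN S14508)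

Blind re-derivation cell `pub-hodge-repro`, Tier 4 (README §9–§10), seat t4-L1-p3 (prover, LINE L1, gen 3).  Target tree
path `lean/Summits/Ventures/HodgeRepro/Tier4/Line1/HeckeAlgLeftType.lean`.  Imports this seat's `IsotypicHeckeAlgebra`
(p692571: `HeckeAlg`, `integrable_conv_integrand`) and `IsotypicIdempotent` (p690327: `repExt`, `eσ`), t4-L1-p2's
`LeftTypeOfMatrixCoeff` (p684394: `HasFiniteRankLeftType`).  0 printed inputs.

CONTENT.  `typeTest i j h := (d · μ(K)⁻¹) · conj repExt(h)_{ji}` (the `(i, j)`-th test function of the type, supported on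
`K`; `isTest_typeTest`); **`eσ_inv_mul : eσ (k⁻¹ h) = ∑_{i j} conj ρ(k⁻¹)_{ij} · typeTest i j h`** (on `K`: `repExt_mul`
and the trace of a product as a double sum; off `K` both sides vanish); **`hasFiniteRankLeftType_of_mem_heckeAlg`** (THE
CUT): for `t ∈ H_σ`, `t = eσ ⋆ t`, so `t(k⁻¹ g) = ∫ eσ(h) t(h⁻¹ k⁻¹ g) dμ = ∫ eσ(k⁻¹ h') t(h'⁻¹ g) dμ` (the substitution
`h = k⁻¹ h'`, left invariance of `S.μ`) `= ∑_{i j} conj ρ(k⁻¹)_{ij} · (typeTest i j ⋆ t)(g)` — a left-`K`-type of rank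
`d · d` with coefficient functions `e_{ij}(k) = conj ρ(k⁻¹)_{ij}` and test functions `typeTest i j ⋆ t` (`conv_isTest`);
the generic `HasFiniteRankLeftType.cj` (conjugate the identity); `hasFiniteRankLeftType_cj_of_mem_heckeAlg` for the
first test `cj t` of a `RealisedHecke` pair.  WHY (plan-1 S14477): on p2's (S1b) row the clause
`∀ γ, HasFiniteRankLeftType (finLevel pl N) (tf γ).1` is displayed data of the Hecke choice; for families
`tf γ = (cj t_γ, refl t'_γ)` with `t_γ ∈ H_σ` at `K = finLevel pl N` it is a THEOREM by name.  Junk tests: `d = 0`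
(`eσ = 0`, `H_σ = {0}`, rank `0`), `t = eσ`, `K = ⊤`.  Nothing here moves (P).  Nothing here says anything about the
status of the Hodge conjecture for CM abelian varieties, which is NOT proved (HC_CM is NOT proved by anyone in this
repository).
-/

set_option autoImplicit false

noncomputable section

namespace Summit.Ventures.HodgeRepro.Tier4.Line1

open MeasureTheory Topology Matrix

namespace RTF

variable {G : Type} [Group G] [TopologicalSpace G] [IsTopologicalGroup G] [MeasurableSpace G] [BorelSpace G]
  {K : Subgroup G}

omit [IsTopologicalGroup G] [MeasurableSpace G] [BorelSpace G] in
/-- the conjugate of a function of finite-rank left-`K`-type has finite-rank left-`K`-type (same rank: conjugate the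
coefficient functions and the test functions). -/
theorem HasFiniteRankLeftType.cj {f : G → ℂ} (hf : HasFiniteRankLeftType K f) :
    HasFiniteRankLeftType K (RTF.cj f) := by
  obtain ⟨r, e, c, hc, hdec⟩ := hf
  refine ⟨r, fun i k => starRingEnd ℂ (e i k), fun i => RTF.cj (c i), fun i => IsTest.cj (hc i), ?_⟩
  intro k g
  simp only [RTF.cj, hdec k g, map_sum, map_mul]

end RTF

namespace RTF.Setting

variable {G : Type} [Group G] [TopologicalSpace G] [IsTopologicalGroup G] [MeasurableSpace G] [BorelSpace G]
  (S : Setting G) (K : Subgroup G) {d : ℕ} (ρ : K →* Matrix (Fin d) (Fin d) ℂ)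
  (hKo : IsOpen (K : Set G)) (hKc : IsCompact (K : Set G)) (hρ : Continuous ρ) (hirr : IsIrreducibleRep ρ)

/-- the `(i, j)`-th test function of the type: `c_{ij}(h) = (d · μ(K)⁻¹) · conj repExt(h)_{ji}` (supported on `K`). -/
def typeTest (i j : Fin d) (h : G) : ℂ :=
  ((d : ℂ) * ((((S.μ (K : Set G)).toReal)⁻¹ : ℝ) : ℂ)) * starRingEnd ℂ (repExt K ρ h j i)

omit [BorelSpace G] in
include hKo hKc hρ in
/-- `c_{ij}` is a test function (continuous by `continuous_repExt`; support in the compact `K`). -/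
theorem isTest_typeTest (i j : Fin d) : IsTest (typeTest S K ρ i j) :=
  ⟨continuous_const.mul (continuous_star.comp ((continuous_repExt K ρ hKo hρ).matrix_elem j i)),
    HasCompactSupport.intro' hKc (K.isClosed_of_isOpen hKo) fun g hg => by
      simp [typeTest, repExt_of_not_mem K ρ hg]⟩

omit [IsTopologicalGroup G] [BorelSpace G] in
/-- **the left translates of `eσ` are spanned by the `c_{ij}`**: `eσ(k⁻¹ h) = ∑_{i j} conj ρ(k⁻¹)_{ij} · c_{ij}(h)`. -/
theorem eσ_inv_mul (k : K) (h : G) :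
    eσ S K ρ ((k : G)⁻¹ * h) = ∑ i, ∑ j, starRingEnd ℂ (ρ k⁻¹ i j) * typeTest S K ρ i j h := by
  by_cases hh : h ∈ K
  · unfold eσ charExt typeTest
    have hk : repExt K ρ ((k : G)⁻¹ * h) = ρ k⁻¹ * repExt K ρ h := by
      rw [repExt_mul K ρ (K.inv_mem k.2) hh, repExt_of_mem K ρ (K.inv_mem k.2)]
      rfl
    rw [hk]
    simp only [Matrix.trace, Matrix.diag, Matrix.mul_apply, map_sum, map_mul, Finset.mul_sum]
    refine Finset.sum_congr rfl fun i _ => Finset.sum_congr rfl fun j _ => ?_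
    ring
  · have hk : (k : G)⁻¹ * h ∉ K := fun hc => hh (by simpa using K.mul_mem k.2 hc)
    rw [eσ_of_not_mem S K ρ hk]
    simp [typeTest, repExt_of_not_mem K ρ hh]

variable [SecondCountableTopology G] [T2Space G] [MeasurableMul G] [SFinite S.μ]

omit [SecondCountableTopology G] [SFinite S.μ] in
include hKo hKc hρ hirr in
/-- **THE CUT (C-TYPE): every element of `H_σ` has finite-rank left-`K`-type** (rank `d²`, coefficient functions
`e_{ij}(k) = conj ρ(k⁻¹)_{ij}`, test functions `c_{ij} ⋆ t`): from `t = eσ ⋆ t`, `eσ_inv_mul` and the left invariance of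
`S.μ` under `h ↦ k⁻¹ h`. -/
theorem hasFiniteRankLeftType_of_mem_heckeAlg {t : G → ℂ} (ht : t ∈ HeckeAlg S K ρ hKo hKc hρ hirr) :
    HasFiniteRankLeftType K t := by
  haveI := S.haar
  refine ⟨d * d,
    fun p k => starRingEnd ℂ (ρ k⁻¹ (finProdFinEquiv.symm p).1 (finProdFinEquiv.symm p).2),
    fun p => S.conv (typeTest S K ρ (finProdFinEquiv.symm p).1 (finProdFinEquiv.symm p).2) t,
    fun p => (S.conv_isTest (S.isTest_typeTest K ρ hKo hKc hρ _ _) ht.1).1, ?_⟩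
  intro k g
  -- `t = eσ ⋆ t` and the substitution `h ↦ k⁻¹ h`
  have h1 : t ((k : G)⁻¹ * g) = ∫ h, eσ S K ρ ((k : G)⁻¹ * h) * t (h⁻¹ * g) ∂S.μ := by
    conv_lhs => rw [← ht.2.1]
    unfold conv
    have hsub := integral_mul_left_eq_self (μ := S.μ)
      (fun h => eσ S K ρ ((k : G)⁻¹ * h) * t (h⁻¹ * g)) (k : G)
    rw [← hsub]
    congr 1
    funext h
    simp only [inv_mul_cancel_left, _root_.mul_inv_rev, mul_assoc, inv_mul_cancel_left]
  -- expand `eσ (k⁻¹ h)` and integrate term by term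
  have h2 : ∀ h, eσ S K ρ ((k : G)⁻¹ * h) * t (h⁻¹ * g)
      = ∑ i, ∑ j, starRingEnd ℂ (ρ k⁻¹ i j) * (typeTest S K ρ i j h * t (h⁻¹ * g)) := by
    intro h
    rw [S.eσ_inv_mul K ρ k h, Finset.sum_mul]
    refine Finset.sum_congr rfl fun i _ => ?_
    rw [Finset.sum_mul]
    refine Finset.sum_congr rfl fun j _ => ?_
    ring
  have hint : ∀ i j, Integrable (fun h => starRingEnd ℂ (ρ k⁻¹ i j) * (typeTest S K ρ i j h * t (h⁻¹ * g))) S.μ :=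
    fun i j => (S.integrable_conv_integrand (S.isTest_typeTest K ρ hKo hKc hρ i j) ht.1 g).const_mul _
  rw [h1]
  simp_rw [h2]
  rw [integral_finsetSum _ fun i _ => integrable_finsetSum _ fun j _ => hint i j]
  simp_rw [integral_finsetSum _ fun j _ => hint _ j, integral_const_mul]
  -- reindex the double sum by `Fin (d * d)`
  rw [← (finProdFinEquiv (m := d) (n := d)).sum_comp]
  simp only [Equiv.symm_apply_apply]
  rw [Fintype.sum_prod_type]
  rfl

omit [SecondCountableTopology G] [SFinite S.μ] in
include hKo hKc hρ hirr in
/-- the first test of a `RealisedHecke` pair, `cj t` with `t ∈ H_σ`, has finite-rank left-`K`-type. -/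
theorem hasFiniteRankLeftType_cj_of_mem_heckeAlg {t : G → ℂ} (ht : t ∈ HeckeAlg S K ρ hKo hKc hρ hirr) :
    HasFiniteRankLeftType K (cj t) :=
  (S.hasFiniteRankLeftType_of_mem_heckeAlg K ρ hKo hKc hρ hirr ht).cj

end RTF.Setting

end Summit.Ventures.HodgeRepro.Tier4.Line1
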